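import Summits.KontsevichZagierPeriods.Statement

/-!
# KontsevichZagierPeriods / AyoubSpecialisation — π-localisation assembly

Problem `KontsevichZagierPeriods`, topic `AyoubSpecialisation`. The pivoted route
(stmt-KontsevichZagierPeriods-0538) splits the kernel conjecture along the element `[π]`:
`PiLocalKernel` (every `c ∈ ker eval` has `[π]^N ⋆ c ∈ relations` for some `N`) and
`PiCancellation` (`[π] ⋆ c ∈ relations → c ∈ relations`). The assembly
stmt-KontsevichZagierPeriods-0539 uses nothing about the product `⋆` or about `[π]` beyond these
two hypotheses (powers taken left-nested, `(mul p)^[N] c`), so it is stated and proved here for an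
ARBITRARY biadditive product `mul : FormalRep →+ FormalRep →+ FormalRep` and an arbitrary element
`p : FormalRep`; once `Literature.NumberTheory.Transcendental.KZ.FormalRep.mul` / `Literature.NumberTheory.Transcendental.KZ.piRep` (def wi-04087) land, the route's
`Literature.KZ.PiLocalKernel ∧ Literature.KZ.PiCancellation → Literature.Periods.KZKernelConjecture` is the instance
`mul := FormalRep.mul`, `p := of piRep`. Proof: induction on `N`.
[Kontsevich–Zagier 2001, §1.2; Huber–Müller-Stach 2017, §13.1 (P = P⁺[(2πi)⁻¹])]
-/

namespace Summit.KontsevichZagierPeriods.AyoubSpecialisation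

/-- Settles stmt-KontsevichZagierPeriods-0539 (assembly, generalised over the product and the
π-element): if every `c ∈ ker KZ.eval` satisfies `(mul p)^[N] c ∈ KZ.relations` for some `N`
(π-local kernel) and `mul p c ∈ KZ.relations → c ∈ KZ.relations` (π-cancellation), then
`ker KZ.eval = KZ.relations` (`Literature.NumberTheory.Transcendental.KZKernelConjecture`). [folklore] -/
theorem kzKernelConjecture_of_piLocalKernel_of_piCancellation
    (mul : Literature.NumberTheory.Transcendental.KZ.FormalRep →+ Literature.NumberTheory.Transcendental.KZ.FormalRep →+ Literature.NumberTheory.Transcendental.KZ.FormalRep) (p : Literature.NumberTheory.Transcendental.KZ.FormalRep)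
    (hLocal : ∀ c : Literature.NumberTheory.Transcendental.KZ.FormalRep, Literature.NumberTheory.Transcendental.KZ.eval c = 0 →
      ∃ N : ℕ, (mul p)^[N] c ∈ Literature.NumberTheory.Transcendental.KZ.relations)
    (hCancel : ∀ c : Literature.NumberTheory.Transcendental.KZ.FormalRep, mul p c ∈ Literature.NumberTheory.Transcendental.KZ.relations → c ∈ Literature.NumberTheory.Transcendental.KZ.relations) :
    Literature.NumberTheory.Transcendental.KZKernelConjecture := by
  intro c hc
  obtain ⟨N, hN⟩ := hLocal c hc
  clear hc
  induction N generalizing c with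
  | zero => simpa using hN
  | succ N ih =>
    exact hCancel c (ih (mul p c) (by simpa [Function.iterate_succ_apply] using hN))

/-- Settles stmt-KontsevichZagierPeriods-0539 in its typed (interface) form, literally
`(signature of stmt-KontsevichZagierPeriods-0538) → KZKernelConjecture`: here `P n r : IntegralRep (n + 2)`
is the product representation `[π] ⋆ r` (closed unit disc in the two leading coordinates, `r` in the
trailing `n`), pinned by its domain and integrand (the other fields of `IntegralRep` are Props, so `P`
is unique once it exists), and `FreeAbelianGroup.lift (fun s => of (P s.1 s.2))` is left multiplication
by `[π]` on `FormalRep`. Assembly of route AyoubSpecialisation, pivot form: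
existence of the `[π] ⋆ ·` product ∧ PiLocalKernel ∧ PiCancellation → `KZKernelConjecture`
(hence `KontsevichZagierPeriods` by `KernelForm/KernelImpliesStatement`). Induction on the
exponent `N`, peeling one `[π]` factor at a time with PiCancellation; the pinning hypotheses on
`P` are not used. [folklore] -/
theorem kzKernelConjecture_of_ayoubPivotThesis :
    (∃ (P : ∀ n : ℕ, Literature.NumberTheory.Transcendental.KZ.IntegralRep n → Literature.NumberTheory.Transcendental.KZ.IntegralRep (n + 2)),
      (∀ (n : ℕ) (r : Literature.NumberTheory.Transcendental.KZ.IntegralRep n),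
        (P n r).domain = {z : Fin (n + 2) → ℝ | z 0 ^ 2 + z 1 ^ 2 ≤ 1 ∧ (fun i : Fin n => z i.succ.succ) ∈ r.domain} ∧
        (P n r).integrand = fun z => r.integrand (fun i : Fin n => z i.succ.succ)) ∧
      (∀ c : Literature.NumberTheory.Transcendental.KZ.FormalRep, Literature.NumberTheory.Transcendental.KZ.eval c = 0 →
        ∃ N : ℕ, (⇑(FreeAbelianGroup.lift (fun s : (Σ n, Literature.NumberTheory.Transcendental.KZ.IntegralRep n) => Literature.NumberTheory.Transcendental.KZ.of (P s.1 s.2))))^[N] c ∈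
          Literature.NumberTheory.Transcendental.KZ.relations) ∧
      (∀ c : Literature.NumberTheory.Transcendental.KZ.FormalRep,
        FreeAbelianGroup.lift (fun s : (Σ n, Literature.NumberTheory.Transcendental.KZ.IntegralRep n) => Literature.NumberTheory.Transcendental.KZ.of (P s.1 s.2)) c ∈ Literature.NumberTheory.Transcendental.KZ.relations →
        c ∈ Literature.NumberTheory.Transcendental.KZ.relations)) →
    Literature.NumberTheory.Transcendental.KZKernelConjecture := by
  rintro ⟨P, -, hloc, hcancel⟩ c hc
  obtain ⟨N, hN⟩ := hloc c hc
  induction N with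
  | zero => simpa using hN
  | succ N ih =>
    exact ih (hcancel _ (by simpa only [Function.iterate_succ_apply'] using hN))

end Summit.KontsevichZagierPeriods.AyoubSpecialisation
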